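import Summits.CriticalPhenomena.Ising3DConformalLimit.Theorems.EnergyNotSigmaSquaredRungOneAdjacentMergingAssemblyAux

/-!
# `Assembly` (= registered stub `stub_assembly` of line `dominant-shell-concentration`,
# crux `RungOneAdjacentMerging`, item stmt-CriticalPhenomena-11262) — candidate proof (drefute gen 3)

Refuter work file (refuter-drefute-stmt-CriticalPhenomena-11262-g3-0).  A sorry-free proof of
`Assembly : TowardCells → WindowRegular → ShareHarvest → VarianceBound` from the lead's landed
auxiliary lemmas (`Theorems/EnergyNotSigmaSquaredRungOneAdjacentMergingAssemblyAux.lean`, p73984):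
the strongest possible certificate that the stub is not misstated.  Positive statements are not the
refuter's to land: this file travels as candidate evidence for the lead prover.

Structure: `infVolWeights_of_blocks` (abstract: cell-indexed weights + block bounds ⇒ `InfVolWeights`),
`summand_le` (pointwise pair bound through the cone reduction, both systems), `block_cross_le`,
`block_diag_le`, and `assembly_proof : Assembly` (constants: `η₁ = min η 16`,
`τ = min (1/16) (η₁/(8(C+1)))`, `M = 8/(c₀ η₁)`, `k₀ = 4`, `R = 2^(sup 𝒦 + 4)`, weights
`w_k = share k / Σ_𝒦 share`, `c(u) = Σ_k 1[u ∈ U_k] w_k/(|U_k| dens dens')`).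
-/

noncomputable section

open Finset
open scoped BigOperators
open Literature.Probability.LatticeModels

namespace Summit.CriticalPhenomena.Ising3DConformalLimit.RungOneAdjacentMergingDominantShell
namespace AssemblyG3

/-- ABSTRACT ASSEMBLY: cell-indexed nonnegative weights with block means `w_k` (`Σ w = 1`) and block
second sums at most `w_k w_ℓ Q + 1[k = ℓ] D w_k`, `Q + D ≤ (1+η) G(x)²`, give `InfVolWeights η x`. -/
theorem infVolWeights_of_blocks {x : Site 3} {η Q D : ℝ} (𝒦 : Finset ℕ) (V : ℕ → Finset (Site 3))
    (g : ℕ → Site 3 → ℝ) (w : ℕ → ℝ) (hg0 : ∀ k u, 0 ≤ g k u)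
    (hmean : ∀ k ∈ 𝒦, ∑ u ∈ V k, g k u * (dens x u * dens x (u - e₂)) = w k)
    (hw1 : ∑ k ∈ 𝒦, w k = 1)
    (hblock : ∀ k ∈ 𝒦, ∀ ℓ ∈ 𝒦,
      ∑ u ∈ V k, ∑ v ∈ V ℓ, g k u * g ℓ v * (tstep x u v * tstep x (u - e₂) (v - e₂)) ≤
        w k * w ℓ * Q + if k = ℓ then D * w k else 0)
    (hQD : Q + D ≤ (1 + η) * Gc x ^ 2) : InfVolWeights η x := by
  have hVU : ∀ k ∈ 𝒦, V k ⊆ 𝒦.biUnion V := fun k hk => Finset.subset_biUnion_of_mem V hk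
  have hm : ∑ u ∈ 𝒦.biUnion V, (∑ k ∈ 𝒦, if u ∈ V k then g k u else 0) *
      (dens x u * dens x (u - e₂)) = 1 := by
    rw [asm_sum_expand _ 𝒦 V hVU g (fun u => dens x u * dens x (u - e₂)), ← hw1]
    exact Finset.sum_congr rfl hmean
  refine ⟨𝒦.biUnion V, fun u => ∑ k ∈ 𝒦, if u ∈ V k then g k u else 0, ?_, ?_, ?_⟩
  · intro u
    exact Finset.sum_nonneg fun k _ => by
      split_ifs
      · exact hg0 k u
      · exact le_rfl
  · show 0 < ∑ u ∈ 𝒦.biUnion V, (∑ k ∈ 𝒦, if u ∈ V k then g k u else 0) *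
      (dens x u * dens x (u - e₂))
    rw [hm]
    exact one_pos
  · show ∑ u ∈ 𝒦.biUnion V, ∑ v ∈ 𝒦.biUnion V, (∑ k ∈ 𝒦, if u ∈ V k then g k u else 0) *
        (∑ k ∈ 𝒦, if v ∈ V k then g k v else 0) * (tstep x u v * tstep x (u - e₂) (v - e₂)) ≤
      (1 + η) * Gc x ^ 2 * (∑ u ∈ 𝒦.biUnion V, (∑ k ∈ 𝒦, if u ∈ V k then g k u else 0) *
        (dens x u * dens x (u - e₂))) ^ 2
    rw [hm, asm_sum_expand₂ _ 𝒦 V hVU g (fun u v => tstep x u v * tstep x (u - e₂) (v - e₂))]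
    calc ∑ k ∈ 𝒦, ∑ ℓ ∈ 𝒦, ∑ u ∈ V k, ∑ v ∈ V ℓ,
          g k u * g ℓ v * (tstep x u v * tstep x (u - e₂) (v - e₂))
        ≤ ∑ k ∈ 𝒦, ∑ ℓ ∈ 𝒦, (w k * w ℓ * Q + if k = ℓ then D * w k else 0) :=
          Finset.sum_le_sum fun k hk => Finset.sum_le_sum fun ℓ hℓ => hblock k hk ℓ hℓ
      _ = (∑ k ∈ 𝒦, w k) * (∑ k ∈ 𝒦, w k) * Q + D * ∑ k ∈ 𝒦, w k := asm_double_sum_eq 𝒦 w Q D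
      _ = Q + D := by rw [hw1]; ring
      _ ≤ (1 + η) * Gc x ^ 2 := hQD
      _ = (1 + η) * Gc x ^ 2 * 1 ^ 2 := by ring

/-- POINTWISE PAIR BOUND: with weights `s/(m·dens·dens')`, `t/(n·dens·dens')` and `x` seeing
`u, u - e₂, v, v - e₂` in its toward-cone, ratio bounds `X`, `Y` for the two systems with `XY ≤ ρ`
bound the summand by `(st/(mn))·G(x)²·ρ` (cone reduction `asm_tstep_le` twice + `asm_pair_le`). -/
theorem summand_le {x u v : Site 3} {s t m n X Y ρ : ℝ} (hm : 0 < m) (hn : 0 < n) (hs : 0 ≤ s)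
    (ht : 0 ≤ t) (hxu : Gc x ≤ Gc (x - u)) (hxu' : Gc x ≤ Gc (x - (u - e₂)))
    (hxv : Gc x ≤ Gc (x - v)) (hxv' : Gc x ≤ Gc (x - (v - e₂)))
    (hX : Gc (v - u) / Gc v + Gc (u - v) / Gc u ≤ X)
    (hY : Gc (v - u) / Gc (v - e₂) + Gc (u - v) / Gc (u - e₂) ≤ Y) (hρ : X * Y ≤ ρ) :
    s / (m * (dens x u * dens x (u - e₂))) * (t / (n * (dens x v * dens x (v - e₂)))) *
      (tstep x u v * tstep x (u - e₂) (v - e₂)) ≤ s * t / (m * n) * Gc x ^ 2 * ρ := by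
  have hT := asm_tstep_le x u v hxu hxv X hX
  have hT' := asm_tstep_le x (u - e₂) (v - e₂) hxu' hxv' Y
    (by simpa only [sub_sub_sub_cancel_right] using hY)
  exact asm_pair_le (asm_dens_pos x u) (asm_dens_pos x (u - e₂)) (asm_dens_pos x v)
    (asm_dens_pos x (v - e₂)) hm hn hs ht (asm_tstep_nonneg x u v) (asm_tstep_nonneg x _ _)
    hT hT' hρ

/-- CROSS BLOCK: a uniform pointwise bound `(st/(mn))·G(x)²·ρ` sums to `st·G(x)²·ρ`. -/
theorem block_cross_le {x : Site 3} {Vk Vl : Finset (Site 3)} {s t ρ : ℝ}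
    (hmk : 0 < (Vk.card : ℝ)) (hml : 0 < (Vl.card : ℝ))
    (hpt : ∀ u ∈ Vk, ∀ v ∈ Vl,
      s / (Vk.card * (dens x u * dens x (u - e₂))) * (t / (Vl.card * (dens x v * dens x (v - e₂)))) *
        (tstep x u v * tstep x (u - e₂) (v - e₂)) ≤ s * t / (Vk.card * Vl.card) * Gc x ^ 2 * ρ) :
    ∑ u ∈ Vk, ∑ v ∈ Vl, s / (Vk.card * (dens x u * dens x (u - e₂))) *
        (t / (Vl.card * (dens x v * dens x (v - e₂)))) * (tstep x u v * tstep x (u - e₂) (v - e₂)) ≤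
      s * t * (Gc x ^ 2 * ρ) := by
  calc ∑ u ∈ Vk, ∑ v ∈ Vl, s / (Vk.card * (dens x u * dens x (u - e₂))) *
        (t / (Vl.card * (dens x v * dens x (v - e₂)))) * (tstep x u v * tstep x (u - e₂) (v - e₂))
      ≤ ∑ u ∈ Vk, ∑ v ∈ Vl, s * t / (Vk.card * Vl.card) * Gc x ^ 2 * ρ :=
        Finset.sum_le_sum fun u hu => Finset.sum_le_sum fun v hv => hpt u hu v hv
    _ = s * t * (Gc x ^ 2 * ρ) := by
        rw [Finset.sum_const, Finset.sum_const, nsmul_eq_mul, nsmul_eq_mul]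
        field_simp

/-- DIAGONAL BLOCK: inside one cell (`G(u), G(u-e₂) ≥ α`, diameter `≤ L`, cone) the block second sum is
at most `(s/m)²·G(x)²·(4/α²)·(m·B(L))` (ratio `≤ 2G(u-v)/α` per system, one bubble row per `u`). -/
theorem block_diag_le {x : Site 3} {W : Finset (Site 3)} {s α L : ℝ} (hm : 0 < (W.card : ℝ))
    (hs : 0 ≤ s) (hα : 0 < α)
    (hcone : ∀ u ∈ W, Gc x ≤ Gc (x - u) ∧ Gc x ≤ Gc (x - (u - e₂)) ∧ α ≤ Gc u ∧ α ≤ Gc (u - e₂))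
    (hdiam : ∀ u ∈ W, ∀ v ∈ W, ‖u - v‖ ≤ L) :
    ∑ u ∈ W, ∑ v ∈ W, s / (W.card * (dens x u * dens x (u - e₂))) *
        (s / (W.card * (dens x v * dens x (v - e₂)))) * (tstep x u v * tstep x (u - e₂) (v - e₂)) ≤
      s * s / (W.card * W.card) * Gc x ^ 2 * (4 / α ^ 2) * (W.card * Bub L) := by
  have hrat : ∀ {p q r : Site 3}, α ≤ Gc r → Gc (p - q) ≤ Gc (q - p) / α * Gc r := by
    intro p q r hr
    calc Gc (p - q) = Gc (q - p) / α * α := by rw [asm_Gc_sub_comm p q, div_mul_cancel₀ _ hα.ne']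
      _ ≤ Gc (q - p) / α * Gc r :=
          mul_le_mul_of_nonneg_left hr (div_nonneg (asm_Gc_pos _).le hα.le)
  have hrat' : ∀ {p q r : Site 3}, α ≤ Gc r → Gc (p - q) ≤ Gc (p - q) / α * Gc r := by
    intro p q r hr
    calc Gc (p - q) = Gc (p - q) / α * α := by rw [div_mul_cancel₀ _ hα.ne']
      _ ≤ Gc (p - q) / α * Gc r :=
          mul_le_mul_of_nonneg_left hr (div_nonneg (asm_Gc_pos _).le hα.le)
  have hpt : ∀ u ∈ W, ∀ v ∈ W,
      s / (W.card * (dens x u * dens x (u - e₂))) * (s / (W.card * (dens x v * dens x (v - e₂)))) *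
          (tstep x u v * tstep x (u - e₂) (v - e₂)) ≤
        s * s / (W.card * W.card) * Gc x ^ 2 * (4 / α ^ 2 * Gc (u - v) ^ 2) := by
    intro u hu v hv
    obtain ⟨hxu, hxu', hau, hau'⟩ := hcone u hu
    obtain ⟨hxv, hxv', hav, hav'⟩ := hcone v hv
    have hX : Gc (v - u) / Gc v + Gc (u - v) / Gc u ≤ Gc (u - v) / α + Gc (u - v) / α :=
      asm_ratio_add_le (asm_Gc_pos v) (asm_Gc_pos u) (hrat hav) (hrat' hau)
    have hY : Gc (v - u) / Gc (v - e₂) + Gc (u - v) / Gc (u - e₂) ≤ Gc (u - v) / α + Gc (u - v) / α :=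
      asm_ratio_add_le (asm_Gc_pos _) (asm_Gc_pos _) (hrat hav') (hrat' hau')
    exact summand_le hm hm hs hs hxu hxu' hxv hxv' hX hY (le_of_eq (by ring))
  have hrow : ∀ u ∈ W, ∑ v ∈ W, Gc (u - v) ^ 2 ≤ Bub L := fun u hu =>
    asm_sum_sq_le_Bub u W fun v hv => hdiam u hu v hv
  have hnn : 0 ≤ s * s / (W.card * W.card) * Gc x ^ 2 * (4 / α ^ 2) := by positivity
  calc ∑ u ∈ W, ∑ v ∈ W, s / (W.card * (dens x u * dens x (u - e₂))) *
        (s / (W.card * (dens x v * dens x (v - e₂)))) * (tstep x u v * tstep x (u - e₂) (v - e₂))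
      ≤ ∑ u ∈ W, ∑ v ∈ W, s * s / (W.card * W.card) * Gc x ^ 2 * (4 / α ^ 2 * Gc (u - v) ^ 2) :=
        Finset.sum_le_sum fun u hu => Finset.sum_le_sum fun v hv => hpt u hu v hv
    _ = s * s / (W.card * W.card) * Gc x ^ 2 * (4 / α ^ 2) * ∑ u ∈ W, ∑ v ∈ W, Gc (u - v) ^ 2 := by
        rw [Finset.mul_sum]
        refine Finset.sum_congr rfl fun u _ => ?_
        rw [Finset.mul_sum]
        exact Finset.sum_congr rfl fun v _ => by ring
    _ ≤ s * s / (W.card * W.card) * Gc x ^ 2 * (4 / α ^ 2) * (W.card * Bub L) := by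
        refine mul_le_mul_of_nonneg_left ?_ hnn
        calc ∑ u ∈ W, ∑ v ∈ W, Gc (u - v) ^ 2 ≤ ∑ u ∈ W, Bub L := Finset.sum_le_sum hrow
          _ = W.card * Bub L := by rw [Finset.sum_const, nsmul_eq_mul]

/-- **`Assembly` (candidate proof of the registered stub `stub_assembly`).** -/
theorem assembly_proof : Assembly := by
  intro hcells hwin hharv η hη
  obtain ⟨c₀, hc₀, hcell⟩ := hcells
  obtain ⟨A, hA1, hH⟩ := hharv
  obtain ⟨C, hC0, hW⟩ := hwin A hA1
  -- constants
  set η₁ : ℝ := min η 16 with hη₁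
  have hη₁0 : 0 < η₁ := lt_min hη (by norm_num)
  have hη₁16 : η₁ ≤ 16 := min_le_right _ _
  have hη₁η : η₁ ≤ η := min_le_left _ _
  have hC1 : 0 < C + 1 := by linarith
  set τ : ℝ := min (1 / 16) (η₁ / (8 * (C + 1))) with hτ
  have hτ0 : 0 < τ := lt_min (by norm_num) (div_pos hη₁0 (by positivity))
  have hτ16 : τ ≤ 1 / 16 := min_le_left _ _
  have ht0 : 0 ≤ (C + 1) * τ := by positivity
  have ht : (C + 1) * τ ≤ η₁ / 8 := by
    have h1 : τ ≤ η₁ / (8 * (C + 1)) := min_le_right _ _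
    rw [le_div_iff₀ (by positivity)] at h1
    linarith
  have hρ : (1 + (C + 1) * τ) * (1 + (C + 1) * τ) ≤ 1 + η₁ / 2 := asm_sq_le ht0 ht hη₁16
  set M : ℝ := 8 / (c₀ * η₁) with hM
  have hM0 : 0 < M := div_pos (by norm_num) (mul_pos hc₀ hη₁0)
  obtain ⟨𝒦, hKw, hKsep, hKM⟩ := hH τ hτ0 4 M
  set S : ℝ := ∑ k ∈ 𝒦, share k with hS
  have hS0 : 0 < S := hM0.trans_le hKM
  have h8 : 8 ≤ c₀ * η₁ * S := by
    have h1 : M ≤ S := hKM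
    rw [hM, div_le_iff₀ (mul_pos hc₀ hη₁0)] at h1
    linarith
  -- radius and far point
  refine ⟨(2 : ℝ) ^ (𝒦.sup id + 4), fun x hx => asm_infVolWeights_mono hη₁η ?_⟩
  have hxk : ∀ k ∈ 𝒦, (2 : ℝ) ^ (k + 4) ≤ ‖x‖ := fun k hk =>
    (pow_le_pow_right₀ (by norm_num) (by
      have := Finset.le_sup (f := id) hk
      simp only [id_eq] at this
      omega)).trans hx
  -- cells
  have hex : ∀ k, ∃ U : Finset (Site 3), k ∈ 𝒦 →
      (c₀ * 8 ^ k ≤ (U.card : ℝ) ∧ ∀ u ∈ U,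
        (2 : ℝ) ^ (k - 1) ≤ ‖u‖ ∧ ‖u‖ ≤ (2 : ℝ) ^ k ∧
        Gc x ≤ Gc (x - u) ∧ Gc x ≤ Gc (x - (u - e₂)) ∧
        axisG (2 ^ (k + 2)) ≤ Gc u ∧ axisG (2 ^ (k + 2)) ≤ Gc (u - e₂)) := by
    intro k
    by_cases hk : k ∈ 𝒦
    · obtain ⟨U, hU⟩ := hcell k (hKw k hk).1 x (hxk k hk)
      exact ⟨U, fun _ => hU⟩
    · exact ⟨∅, fun h => (hk h).elim⟩
  choose V hV using hex
  have hm : ∀ k ∈ 𝒦, 0 < ((V k).card : ℝ) := fun k hk =>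
    lt_of_lt_of_le (by positivity) (hV k hk).1
  have hw0 : ∀ k, 0 ≤ share k / S := fun k => div_nonneg (share_nonneg k) hS0.le
  -- the abstract assembly with share-proportional weights
  refine infVolWeights_of_blocks (Q := Gc x ^ 2 * (1 + η₁ / 2)) (D := 4 / (c₀ * S) * Gc x ^ 2) 𝒦 V
    (fun k u => share k / S / ((V k).card * (dens x u * dens x (u - e₂)))) (fun k => share k / S)
    ?_ ?_ ?_ ?_ ?_
  · -- nonnegativity
    intro k u
    exact div_nonneg (hw0 k) (mul_nonneg (Nat.cast_nonneg _)
      (mul_nonneg (asm_dens_pos x u).le (asm_dens_pos x _).le))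
  · -- block means
    intro k hk
    have hterm : ∀ u ∈ V k, share k / S / ((V k).card * (dens x u * dens x (u - e₂))) *
        (dens x u * dens x (u - e₂)) = share k / S / (V k).card := by
      intro u _
      have hd : dens x u * dens x (u - e₂) ≠ 0 :=
        (mul_pos (asm_dens_pos x u) (asm_dens_pos x _)).ne'
      rw [div_mul_eq_mul_div, mul_div_mul_right _ _ hd]
    rw [Finset.sum_congr rfl hterm, Finset.sum_const, nsmul_eq_mul, mul_div_cancel₀ _ (hm k hk).ne']
  · -- total weight one
    rw [← Finset.sum_div, div_self hS0.ne']
  · -- block bounds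
    intro k hk ℓ hℓ
    obtain ⟨hcardk, huk⟩ := hV k hk
    obtain ⟨hcardl, hvl⟩ := hV ℓ hℓ
    rcases lt_trichotomy k ℓ with hkl | rfl | hlk
    · -- cross, k < ℓ : u small, v large
      rw [if_neg hkl.ne, add_zero]
      refine block_cross_le (hm k hk) (hm ℓ hℓ) fun u hu v hv => ?_
      obtain ⟨-, hu2, hxu, hxu', hau, hau'⟩ := huk u hu
      obtain ⟨hv1, hv2, hxv, hxv', -, -⟩ := hvl v hv
      have hc := asm_cross hC0 hτ0.le hτ16 hW (hKw ℓ hℓ).1 (hKw ℓ hℓ).2 (hKsep k hk ℓ hℓ hkl).1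
        (hKsep k hk ℓ hℓ hkl).2 hu2 hv1 hv2 hau hau'
      have e : 1 + C * τ + τ = 1 + (C + 1) * τ := by ring
      have hX : Gc (v - u) / Gc v + Gc (u - v) / Gc u ≤ 1 + (C + 1) * τ :=
        (asm_ratio_add_le (asm_Gc_pos v) (asm_Gc_pos u) hc.1 hc.2.2.1).trans_eq e
      have hY : Gc (v - u) / Gc (v - e₂) + Gc (u - v) / Gc (u - e₂) ≤ 1 + (C + 1) * τ :=
        (asm_ratio_add_le (asm_Gc_pos _) (asm_Gc_pos _) hc.2.1 hc.2.2.2).trans_eq e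
      exact summand_le (hm k hk) (hm ℓ hℓ) (hw0 k) (hw0 ℓ) hxu hxu' hxv hxv' hX hY hρ
    · -- diagonal
      rw [if_pos rfl]
      have hdiam : ∀ u ∈ V k, ∀ v ∈ V k, ‖u - v‖ ≤ (2 : ℝ) ^ (k + 1) := by
        intro u hu v hv
        have h1 := (huk u hu).2.1
        have h2 := (huk v hv).2.1
        have h3 := norm_sub_le u v
        rw [pow_succ]
        linarith
      have hd := block_diag_le (L := (2 : ℝ) ^ (k + 1)) (hm k hk) (hw0 k) (asm_axisG_pos (2 ^ (k + 2)))
        (fun u hu => ⟨(huk u hu).2.2.1, (huk u hu).2.2.2.1, (huk u hu).2.2.2.2.1,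
          (huk u hu).2.2.2.2.2⟩) hdiam
      have hE : c₀ * S * (8 ^ k / S) ≤ (V k).card := by
        have : c₀ * S * (8 ^ k / S) = c₀ * 8 ^ k := by field_simp
        rw [this]
        exact hcardk
      have hsh : share k / S = 8 ^ k / S * axisG (2 ^ (k + 2)) ^ 2 / Bub (2 ^ (k + 1)) := by
        rw [share]
        ring
      have hdc := asm_diag_const (G := Gc x) hsh (asm_Bub_pos (by positivity)) (asm_axisG_pos _)
        (hm k hk) (mul_pos hc₀ hS0) (by positivity) hE
      have hnn : 0 ≤ share k / S * (share k / S) * (Gc x ^ 2 * (1 + η₁ / 2)) :=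
        mul_nonneg (mul_nonneg (hw0 k) (hw0 k)) (by positivity)
      linarith [hd.trans hdc]
    · -- cross, ℓ < k : u large, v small
      rw [if_neg hlk.ne', add_zero]
      refine block_cross_le (hm k hk) (hm ℓ hℓ) fun u hu v hv => ?_
      obtain ⟨hu1, hu2, hxu, hxu', hau, hau'⟩ := huk u hu
      obtain ⟨-, hv2, hxv, hxv', hav, hav'⟩ := hvl v hv
      have hc := asm_cross hC0 hτ0.le hτ16 hW (hKw k hk).1 (hKw k hk).2 (hKsep ℓ hℓ k hk hlk).1
        (hKsep ℓ hℓ k hk hlk).2 hv2 hu1 hu2 hav hav'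
      have e : τ + (1 + C * τ) = 1 + (C + 1) * τ := by ring
      have hX : Gc (v - u) / Gc v + Gc (u - v) / Gc u ≤ 1 + (C + 1) * τ :=
        (asm_ratio_add_le (asm_Gc_pos v) (asm_Gc_pos u) hc.2.2.1 hc.1).trans_eq e
      have hY : Gc (v - u) / Gc (v - e₂) + Gc (u - v) / Gc (u - e₂) ≤ 1 + (C + 1) * τ :=
        (asm_ratio_add_le (asm_Gc_pos _) (asm_Gc_pos _) hc.2.2.2 hc.2.1).trans_eq e
      exact summand_le (hm k hk) (hm ℓ hℓ) (hw0 k) (hw0 ℓ) hxu hxu' hxv hxv' hX hY hρ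
  · -- Q + D ≤ (1 + η₁) G(x)²
    have h4 : 4 / (c₀ * S) ≤ η₁ / 2 := by
      rw [div_le_div_iff₀ (mul_pos hc₀ hS0) (by norm_num : (0 : ℝ) < 2)]
      nlinarith
    have hG2 : 0 ≤ Gc x ^ 2 := sq_nonneg _
    calc Gc x ^ 2 * (1 + η₁ / 2) + 4 / (c₀ * S) * Gc x ^ 2
        = Gc x ^ 2 * (1 + η₁ / 2 + 4 / (c₀ * S)) := by ring
      _ ≤ Gc x ^ 2 * (1 + η₁) := mul_le_mul_of_nonneg_left (by linarith) hG2
      _ = (1 + η₁) * Gc x ^ 2 := by ring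

/-- The registered stub signature, verbatim. -/
theorem stub_assembly_candidate : TowardCells → WindowRegular → ShareHarvest →
    ∀ η : ℝ, 0 < η → ∃ R : ℝ, ∀ x : Site 3, R ≤ ‖x‖ → InfVolWeights η x :=
  assembly_proof

end AssemblyG3
end Summit.CriticalPhenomena.Ising3DConformalLimit.RungOneAdjacentMergingDominantShell

end
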